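import Summits.CriticalPhenomena.SAWScalingLimit.Theorems.SAWStressTensorSimpleSubseqLimitsSplit
import HarnessLib

/-!
# The glue item `ArcSplitGlue` of the ARC split of `SimpleSubseqLimits` on route SAWStressTensor (stmt-CriticalPhenomena-18400)

`ArcSplitGlue := SeqSlitAvoidance → LimitRangeArc → SimpleSubseqLimits` (route SAWStressTensor, rev 4; children
stmt-CriticalPhenomena-18398 / 18399 of the shared crux stmt-CriticalPhenomena-4514, crux strategist r1 session B).
Its content is the LANDED assembly `ArcSplitEC.stressTensor_of_arcSubs` (p167904; route-neutral core
`ArcSplitEC.core_of_seqSlitAvoidance_rangeArc`, p167883 — lead c9's soft transfer and closing re-hosted on the value-free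
SHAPE hypothesis); `--glue-by` could not cite it inside the route file (glue.cyclic-import), so the split carries this
glue ITEM and this file closes it. The children decls unfold definitionally to the texts the landed theorem is stated
over. [folklore]
-/

namespace Summit.CriticalPhenomena.SAWScalingLimit.Theorems.SimpleSubseqLimits.SlitRestriction.ArcSplitEC

/-- **Proof of the glue item stmt-CriticalPhenomena-18400** (`SAWStressTensor.ArcSplitGlue`): the ORDER child and the
SHAPE child give the parent crux, by the landed `stressTensor_of_arcSubs`. [folklore] -/
theorem ArcSplitGlue_proof : Summit.CriticalPhenomena.SAWScalingLimit.Theses.SAWStressTensor.ArcSplitGlue :=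
  fun h₁ h₂ => stressTensor_of_arcSubs h₁ h₂

end Summit.CriticalPhenomena.SAWScalingLimit.Theorems.SimpleSubseqLimits.SlitRestriction.ArcSplitEC
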